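import Summits.CriticalPhenomena.CardyFormulaZ2.Theorems.CardyIKTransportIKMixedBoxCrossingDefectDefs
import Summits.CriticalPhenomena.CardyFormulaZ2.Theorems.CardyIKTransportIKMixedBoxCrossingDefs

/-!
# Line `defect-closure-exploration`, reshape v3 (lead c2) — VOCABULARY + COMPOSITION of the straight-cut
# second-moment junction for the crux `IKMixedBoxCrossing` (stmt-CriticalPhenomena-5911)

Definitions-only support file (same device as `…DefectDefs.lean`, p97097). Nothing is asserted: every
`def … : Prop` is a statement the LINE POSITS (a parametrised sub-goal of the crux, proved by a registered stub or
by the glue, never a literature fact); the registered stubs are the `sorry`s of the lead's skeleton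
`Cruxes/IKMixedBoxCrossing/Lines/defect_closure_exploration.lean`; the compositions below are sorry-free.

THE RESHAPE. The open layer `stub_pureIK` (FKG-free RSW at the isotropic point) is decomposed along the ONE
geometric operation the gauge handles exactly — a STRAIGHT CUT. Let `R = [a, a+k) × [-h, h]` be cut by the cell row
`0` into the upper half-box `U = [a, a+k) × [1, h]`, the lower half-box `L = [a, a+k) × [-h, -1]` and the axis
window. The exact Markov property of the colour field across a row (the row-twist structure, landed as
`indepFun_row_twist` p100000 / `condBox_eq_noiseOp` p107975) says that, given the colours `ξ` of the axis window,
events of `U` and events of `L` are independent (`RowFactorisation`, finite cylinder form). Glue at the axis: if the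
cell `(a+i, 1)` is joined to the top row of `U` inside `U`, the axis cell `(a+i, 0)` is black and `(a+i, -1)` is
joined to the bottom row of `L` inside `L`, then `R` is crossed vertically (vertical adjacencies exist in every
triangulation). Counting such glue columns `i` with multiplicity `M`, Cauchy–Schwarz gives
`μ(R crossed vertically) ≥ (E M)² / E M²`, and by `RowFactorisation` both moments are EXPLICIT finite sums of
products of row-conditioned one- and two-point boundary-arm probabilities of the two half-boxes (`glueFirst`,
`glueSecond`): this is `RowGluing` (provable now, every `S`). What is left is ONE inequality,
`ContactSecondMoment`: `E M² ≤ C (E M)²` uniformly in the scale at the isotropic point — a quasi-multiplicativity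
bound for the row-conditioned boundary two-point contact function of the IK field. It carries the whole analytic
weight of RSW here (no squares, no symmetry and no association enter the composition); by the reverse/forward
hypercontractive form of the row noise operator (lead c2 memo `Lines/defect-closure-exploration-c2.md`) it is
within an explicit `n^{(2/3)ρ²/(1+ρ²)}` factor of its unconditioned version, and it is numerically bounded (crux
evidence junction-numerics.md, kit j015217: second-moment ratio 1.6–3, scale-stable). The composition `pureIK_of`
turns `RowGluing + ContactSecondMoment` into `PureIKBoxCrossing` through `GaugeBridge`, `FreeLocality` (the free
model of an isotropic-pure box IS the isotropic free model) and the landed `PatternLocality`, `QuarterTurn`,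
`Monotone'` of the sibling vocabulary `…IKMixedBoxCrossingDefs.lean` (all three kernel-checked under line
paired-mirror: p91915, p91424, p90765).

DISPROOF USED (`Cruxes/IKMixedBoxCrossing/Disproof.lean` v5): `iKMixedBoxCrossing_false_without_n_pos` (`1 ≤ n`
kept in `ContactSecondMoment`), `c_le_quarter` (all constants existential), `colourField_not_positivelyAssociated` /
`bondField_not_positivelyAssociated` (no statement below uses association — the junction is a second moment).
-/

noncomputable section

namespace Summit.CriticalPhenomena.CardyFormulaZ2.Cruxes.IKMixedBoxCrossing.DefectClosureExploration

open scoped BigOperators Classical ENNReal NNReal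
open MeasureTheory Finset
open Literature.Probability.Percolation Literature.Probability.LatticeModels
open Summit.CriticalPhenomena.CardyFormulaZ2.Theorems.IKLinearTransport.PinnedDiagramExchange
  (Ω μIK blackSet antiSet Obs obs νmix blackEdges lrCross tbCross determinedOn)
open Summit.CriticalPhenomena.CardyFormulaZ2.Theorems.IKLinearTransport.PinnedDiagramExchange.CouplingToLimits
  (measurable_obs measurable_blackEdges)
open Summit.CriticalPhenomena.CardyFormulaZ2.Cruxes.IKMixedBoxCrossing.PairedMirrorExploration
  (pLR pTB PatternLocality QuarterTurn Monotone' univ_recentre pLR_two_mul_eq_pH pTB_two_mul_eq_pV)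
open Summit.CriticalPhenomena.CardyFormulaZ2.Theorems.IKMixedBoxCrossing

/-! ## §1 Geometry of the straight cut along the cell row `0` -/

/-- Cylinder of the axis window: the colours of the `k` axis cells `(a+i, 0)`, `i < k`, are `ξ`. -/
def rowCyl (a : ℤ) (k : ℕ) (ξ : Fin k → Bool) : Set Obs :=
  {x | ∀ i : Fin k, ((![a + i, 0] : Site 2) ∈ x.1 ↔ ξ i = true)}

/-- Upper half-box `U = [a, a+k) × [1, h]`. -/
def upBox (a : ℤ) (k h : ℕ) : Set (Site 2) := {v | a ≤ v 0 ∧ v 0 < a + k ∧ 1 ≤ v 1 ∧ v 1 ≤ h}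

/-- Lower half-box `L = [a, a+k) × [-h, -1]`. -/
def loBox (a : ℤ) (k h : ℕ) : Set (Site 2) := {v | a ≤ v 0 ∧ v 0 < a + k ∧ -(h : ℤ) ≤ v 1 ∧ v 1 ≤ -1}

/-- Top row of `U`. -/
def upTop (a : ℤ) (k h : ℕ) : Set (Site 2) := {v | v 1 = h ∧ a ≤ v 0 ∧ v 0 < a + k}

/-- Bottom row of `L`. -/
def loBot (a : ℤ) (k h : ℕ) : Set (Site 2) := {v | v 1 = -(h : ℤ) ∧ a ≤ v 0 ∧ v 0 < a + k}

/-- UPPER BOUNDARY ARM at column `i`: the cell `(a+i, 1)` is black and joined to the top row of `U` by a black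
path inside `U`. -/
def upArm (a : ℤ) (k h : ℕ) (i : Fin k) : Set Obs :=
  {x | (![a + i, 1] : Site 2) ∈ x.1 ∧ blackEdges x ∈ openCrossing (upBox a k h) {![a + i, 1]} (upTop a k h)}

/-- LOWER BOUNDARY ARM at column `i`: the cell `(a+i, -1)` is black and joined to the bottom row of `L` by a
black path inside `L`. -/
def loArm (a : ℤ) (k h : ℕ) (i : Fin k) : Set Obs :=
  {x | (![a + i, -1] : Site 2) ∈ x.1 ∧ blackEdges x ∈ openCrossing (loBox a k h) {![a + i, -1]} (loBot a k h)}

/-! ## §2 Row-conditioned contact moments (explicit finite sums) -/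

/-- FIRST glue moment `E M = Σ_i Σ_{ξ : ξ_i = 1} 2^k ν(upArm_i ∩ C_ξ) ν(loArm_i ∩ C_ξ)`. -/
def glueFirst (S : Set ℤ) (a : ℤ) (k h : ℕ) : ℝ :=
  ∑ i : Fin k, ∑ ξ : Fin k → Bool,
    if ξ i = true then
      (2 : ℝ) ^ k * (νmix S).real (upArm a k h i ∩ rowCyl a k ξ) * (νmix S).real (loArm a k h i ∩ rowCyl a k ξ)
    else 0

/-- SECOND glue moment
`E M² = Σ_{i,j} Σ_{ξ : ξ_i = ξ_j = 1} 2^k ν(upArm_i ∩ upArm_j ∩ C_ξ) ν(loArm_i ∩ loArm_j ∩ C_ξ)`. -/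
def glueSecond (S : Set ℤ) (a : ℤ) (k h : ℕ) : ℝ :=
  ∑ i : Fin k, ∑ j : Fin k, ∑ ξ : Fin k → Bool,
    if ξ i = true ∧ ξ j = true then
      (2 : ℝ) ^ k * (νmix S).real (upArm a k h i ∩ upArm a k h j ∩ rowCyl a k ξ) *
        (νmix S).real (loArm a k h i ∩ loArm a k h j ∩ rowCyl a k ξ)
    else 0

/-! ## §3 Stub statements of the reshape -/

/-- ROW FACTORISATION (exact Markov property of the gauge colour field across a cell row, finite cylinder form,
EVERY column pattern `S`): given the colours of the axis window, an event read on the upper half-box and an event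
read on the lower half-box are independent, and the window itself is uniform (`ν(C_ξ) = 2^{-k}`):
`ν(A ∩ B ∩ C_ξ) = 2^k ν(A ∩ C_ξ) ν(B ∩ C_ξ)`. (Bit bookkeeping of `condBox_eq_noiseOp`'s proof: on `C_ξ ∩ {B 0 = β}`
the upper colours read the row signs `B j`, `j ≥ 1`, the face rows `≥ 0` and the upper coins, the lower colours read
`B j`, `j ≤ -1`, the face rows `≤ -1` and the lower coins, the window reads the column signs and `B 0` — disjoint
coordinates of the product measure.) Size M.
  A statement to be proved (registered stub), not asserted here. -/
def RowFactorisation : Prop :=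
  ∀ (S : Set ℤ) (a : ℤ) (k h : ℕ) (A B : Set Obs), MeasurableSet A → MeasurableSet B →
    A ∈ determinedOn (upBox a k h) → B ∈ determinedOn (loBox a k h) → ∀ ξ : Fin k → Bool,
      (νmix S).real (A ∩ B ∩ rowCyl a k ξ) =
        (2 : ℝ) ^ k * (νmix S).real (A ∩ rowCyl a k ξ) * (νmix S).real (B ∩ rowCyl a k ξ)

/-- ROW GLUING (second-moment junction across a straight cut, EVERY `S`): with `M` = number of columns `i` such
that `upArm_i`, the axis cell `(a+i,0)` is black, and `loArm_i` — each such column glues a vertical crossing of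
`R = [a, a+k) × [-h, h]` — Cauchy–Schwarz `(E M)² ≤ E M² · ν(M ≥ 1)` and `RowFactorisation` give
`glueFirst² ≤ ν(R crossed vertically) · glueSecond`. Size M (given `RowFactorisation`).
  A statement to be proved (registered stub), not asserted here. -/
def RowGluing : Prop :=
  ∀ (S : Set ℤ) (a : ℤ) (k h : ℕ),
    glueFirst S a k h ^ 2 ≤ (νmix S).real (tbCross a (-(h : ℤ)) k (2 * h + 1)) * glueSecond S a k h

/-- CONTACT SECOND MOMENT at the isotropic point (THE OPEN ANALYTIC RESIDUE of the line): the row-conditioned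
boundary two-point contact function of the `n × n` half-boxes is quasi-multiplicative on average —
`E M² ≤ C (E M)²` with `C` uniform in the scale — and the first moment is nonzero. Arm-type statement for a
non-FKG field (Beffara–Gayet's "good behaviour" in second-moment form); numerically `E M²/(E M)² ∈ [1.6, 3]` for
`n ≤ 128` (crux evidence junction-numerics.md, kit j015217).
  A statement to be proved (registered stub), not asserted here. -/
def ContactSecondMoment : Prop :=
  ∃ C : ℝ, 0 < C ∧ ∀ (n : ℕ) (a : ℤ), 1 ≤ n →
    glueSecond Set.univ a n n ≤ C * glueFirst Set.univ a n n ^ 2 ∧ 0 < glueFirst Set.univ a n n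

/-- FREE-MODEL LOCALITY: if every interior face column of the `W × H` rectangle is an `S`-column, its free mixed
model and its crossing events ARE those of the isotropic pattern (same interaction set `facesIn`, same diagonals
inside the box), so `hfree S = hfree univ`, `vfree S = vfree univ` there. Size S.
  A statement to be proved (registered stub), not asserted here. -/
def FreeLocality : Prop :=
  ∀ (S : Set ℤ) (a b : ℤ) (W H : ℕ), (∀ x : ℤ, a ≤ x → x + 1 < a + W → x ∈ S) →
    hfree S a b W H = hfree Set.univ a b W H ∧ vfree S a b W H = vfree Set.univ a b W H

/-! ## §4 Composition (sorry-free) -/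

/-- Second-moment floor: `RowGluing` and `ContactSecondMoment` bound the vertical crossing probability of the
`n × (2n+1)` isotropic box below by `1/C`. -/
theorem tb_floor_of_glue (hG : RowGluing) (hC : ContactSecondMoment) :
    ∃ c : ℝ, 0 < c ∧ ∀ (n : ℕ) (a : ℤ), 1 ≤ n →
      c ≤ (νmix Set.univ).real (tbCross a (-(n : ℤ)) n (2 * n + 1)) := by
  obtain ⟨C, hCpos, hCb⟩ := hC
  refine ⟨1 / C, by positivity, fun n a hn => ?_⟩
  obtain ⟨hD, hN⟩ := hCb n a hn
  have hglue := hG Set.univ a n n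
  have hP0 : 0 ≤ (νmix Set.univ).real (tbCross a (-(n : ℤ)) n (2 * n + 1)) := measureReal_nonneg
  have hN2 : 0 < glueFirst Set.univ a n n ^ 2 := by positivity
  have h1 : glueFirst Set.univ a n n ^ 2 ≤
      (νmix Set.univ).real (tbCross a (-(n : ℤ)) n (2 * n + 1)) * (C * glueFirst Set.univ a n n ^ 2) :=
    hglue.trans (mul_le_mul_of_nonneg_left hD hP0)
  have h2 : 1 ≤ (νmix Set.univ).real (tbCross a (-(n : ℤ)) n (2 * n + 1)) * C := by
    by_contra h
    push Not at h
    nlinarith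
  rw [div_le_iff₀ hCpos]
  linarith

/-- The observable law evaluates crossing events as the gauge does: `(νmix S)(tbCross) = pTB`. -/
theorem nuMix_real_tbCross (S : Set ℤ) (a b : ℤ) (w h : ℕ) :
    (νmix S).real (tbCross a b w h) = pTB S a b w h := by
  have hmeas : MeasurableSet (tbCross a b w h) := by
    unfold tbCross
    exact measurable_blackEdges (measurableSet_openCrossing_of_countable _ _ _)
  rw [pTB, νmix, measureReal_def, measureReal_def, Measure.map_apply (measurable_obs S) hmeas]

/-- The floor transported to the gauge's `n × 2n` boxes at `S = univ`, every position
(`Monotone'` + `PatternLocality`). -/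
theorem pTB_univ_floor (hL : PatternLocality) (hM : Monotone') (hG : RowGluing) (hC : ContactSecondMoment) :
    ∃ c : ℝ, 0 < c ∧ ∀ (n : ℕ) (a b : ℤ), 1 ≤ n → c ≤ pTB Set.univ a b n (2 * n) := by
  obtain ⟨c, hc, hfl⟩ := tb_floor_of_glue hG hC
  refine ⟨c, hc, fun n a b hn => ?_⟩
  have h1 : pTB Set.univ a b n (2 * n + 1) ≤ pTB Set.univ a b n (2 * n) :=
    hM.2 Set.univ a b n (2 * n) (2 * n + 1) (by omega) (by omega)
  have h2 : pTB Set.univ a b n (2 * n + 1) = pTB Set.univ 0 (-(n : ℤ)) n (2 * n + 1) := by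
    rw [(univ_recentre hL a b n (2 * n + 1)).2, (univ_recentre hL 0 (-(n : ℤ)) n (2 * n + 1)).2]
  have h3 := hfl n 0 hn
  rw [nuMix_real_tbCross] at h3
  linarith

/-- **`PureIKBoxCrossing` from the reshaped stubs** (no `sorry`): bridge to the free model, free locality to the
isotropic pattern, quarter turn for the horizontal clause, and the second-moment floor. -/
theorem pureIK_of (hB : GaugeBridge) (hL : PatternLocality) (hQ : QuarterTurn) (hM : Monotone')
    (hF : FreeLocality) (hG : RowGluing) (hC : ContactSecondMoment) : PureIKBoxCrossing := by
  obtain ⟨c, hc, hfl⟩ := pTB_univ_floor hL hM hG hC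
  refine ⟨c, hc, fun S n a b hn => ⟨fun hS => ?_, fun hS => ?_⟩⟩
  · -- horizontal clause: 2n × n box, long way = LR; quarter turn to the vertical clause at the origin
    have hS' : ∀ x : ℤ, a ≤ x → x + 1 < a + ((2 * n : ℕ) : ℤ) → x ∈ S := fun x h1 h2 =>
      hS x h1 (by push_cast at h2; linarith)
    rw [(hF S a b (2 * n) n hS').1, ← (hB Set.univ n a b).1, ← pLR_two_mul_eq_pH,
      (univ_recentre hL a b (2 * n) n).1]
    have hq : pTB Set.univ 0 0 n (2 * n) = pLR Set.univ 0 0 (2 * n) n := by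
      rw [hQ n (2 * n), (univ_recentre hL _ _ (2 * n) n).1]
    rw [← hq]
    exact hfl n 0 0 hn
  · -- vertical clause: n × 2n box, long way = TB
    have hS' : ∀ x : ℤ, a ≤ x → x + 1 < a + ((n : ℕ) : ℤ) → x ∈ S := fun x h1 h2 => hS x h1 h2
    rw [(hF S a b n (2 * n) hS').2, ← (hB Set.univ n a b).2, ← pTB_two_mul_eq_pV]
    exact hfl n a b hn

/-! ## §5 Registered stubs of the reshape (name-keyed aliases) and the registered composition -/

namespace Registered

/-- Alias keyed by the registered stub name. -/
abbrev stub_rowFactorisation : Prop := RowFactorisation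
/-- Alias keyed by the registered stub name. -/
abbrev stub_rowGlue : Prop := RowFactorisation → RowGluing
/-- Alias keyed by the registered stub name (OPEN). -/
abbrev stub_contactSecondMoment : Prop := ContactSecondMoment
/-- Alias keyed by the registered stub name. -/
abbrev stub_freeLocality : Prop := FreeLocality

end Registered

/-- **The reshaped line closes `stub_pureIK`'s target**: the four new stubs plus the landed bridge/structure give
`PureIKBoxCrossing` (hypotheses `PatternLocality`, `QuarterTurn`, `Monotone'` are the landed theorems
`stub_patternLocality`, `stub_quarterTurn`, `stub_monotone`, supplied by the skeleton which imports them). -/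
theorem pureIK_of_stubs :
    PatternLocality → QuarterTurn → Monotone' →
      Registered.stub_bridge → Registered.stub_freeLocality → Registered.stub_rowFactorisation →
      Registered.stub_rowGlue → Registered.stub_contactSecondMoment → PureIKBoxCrossing :=
  fun hL hQ hM hB hF hRF hRG hC => pureIK_of hB hL hQ hM hF (hRG hRF) hC

/-! ## §6 The gauge bridge, split (lead c2): law identity at the origin, then transport to `GaugeBridge` -/

/-- BOX DATA of the `W × H` box at the origin: the colours of its cells `(x, y)` and the coins of the faces with
lower-left cell `(x, y)`, `x < W`, `y < H` (only the inner `S`-faces are ever read). -/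
abbrev BoxData (W H : ℕ) : Type := (Fin W × Fin H → Bool) × (Fin W × Fin H → Bool)

/-- Box data read from the gauge bits (colours `blackSet S ω`, coins `ω.2.2.2.2`). -/
def gaugeBox (S : Set ℤ) (W H : ℕ) (ω : Ω) : BoxData W H :=
  (fun q => decide ((![((q.1 : ℕ) : ℤ), ((q.2 : ℕ) : ℤ)] : Site 2) ∈ blackSet S ω),
    fun q => decide ((![((q.1 : ℕ) : ℤ), ((q.2 : ℕ) : ℤ)] : Site 2) ∈ ω.2.2.2.2))

/-- Box data read from a configuration of the finite free model (colouring `x.1`, coins `x.2`). -/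
def freeBox (W H : ℕ) (x : CellConfig) : BoxData W H :=
  (fun q => x.1 ![((q.1 : ℕ) : ℤ), ((q.2 : ℕ) : ℤ)], fun q => x.2 ![((q.1 : ℕ) : ℤ), ((q.2 : ℕ) : ℤ)])

/-- BRIDGE LAW (refuter facts F1/F2 on stmt-5911, crux NOTES E4): at the origin the gauge's box marginal IS the free
model — the colours of `[0, W) × [0, H)` under `μIK` are `A_x ⊕ B_y ⊕ (parity of the plaquettes in [0,x) × [0,y))`,
i.e. uniform first row/column ⊗ independent inner-face parities (Bernoulli(`2√3−3`) = `t/(1+t)` on `S`-columns, fair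
elsewhere), whose atoms are proportional to `t^{#odd inner S-faces}` exactly as those of
`cornerGibbsMeasure tIK (facesIn S Λ) Λ white`; coins are i.i.d. fair on both sides. Stated as an equality of the
two push-forward laws on the finite type `BoxData W H`. Size M–L.
  A statement to be proved (registered stub), not asserted here. -/
def BridgeLaw : Prop :=
  ∀ (S : Set ℤ) (W H : ℕ),
    μIK.map (gaugeBox S W H) = (boxLaw S (cellRect 0 0 W H)).map (freeBox W H)

namespace Registered

/-- Alias keyed by the registered stub name. -/
abbrev stub_bridgeLaw : Prop := BridgeLaw
/-- Alias keyed by the registered stub name: transport of the law identity to every position and to the crux's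
crossing events (`PatternLocality` for the gauge side, relabelling of the corner Gibbs measure for the free side,
both events read the same `BoxData` event). -/
abbrev stub_bridgeOfLaw : Prop := BridgeLaw → GaugeBridge

end Registered

/-- The gauge bridge from its two registered halves (glue). -/
theorem gaugeBridge_of_stubs : Registered.stub_bridgeLaw → Registered.stub_bridgeOfLaw → GaugeBridge :=
  fun hL hT => hT hL

end Summit.CriticalPhenomena.CardyFormulaZ2.Cruxes.IKMixedBoxCrossing.DefectClosureExploration

end
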